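import Literature.RepresentationTheory.MoeglinVignerasWaldspurger1987.RankOneThetaLiftLineTypes
import Literature.NumberTheory.Automorphic.UnitaryGroupLocalRankThreeCharactersDet
import Literature.NumberTheory.Automorphic.Liu2021.Def411WeilCarriersSurvivalNonsplit
import Literature.RepresentationTheory.SeesawScalarCharacter
import HarnessLib

-- buildfix G11b-3 recipe (as in the GelbartRogawski1991 siblings): sequential elaboration.
set_option Elab.async false

/-!
# Twist rigidity of the rank-one theta lift to `U(3)` in block form, MODULO rank-one×rank-one non-periodicity

Topic `RepresentationTheory/MoeglinVignerasWaldspurger1987`; namespace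
`Literature.RepresentationTheory.MoeglinVignerasWaldspurger1987`.  KERNEL only (theorems; no definition, no named fact,
no `sorry`).  Route R for row IV-4c3 `rankOne_theta_twist_rigidity` of the Hodge/COR-CM interface, block step:

**`twistRigid_block_of_nonPeriodic`** — for `T = t ⊕ᶠ T_H` (`t` a `1 × 1`, `T_H` a `2 × 2` symmetric Gram matrix over
`F`, `J = T ⊗ 1`), a finite place `v` with `E ⊗_F F_v` a field at which the hermitian plane `(E_v², T_H ⊗ 1)` is
ISOTROPIC, a homomorphism `s : U(J)(F_v) →* S̃p(𝕎_v)` over `ι_v` with `ω_s` smooth, unitary continuous characters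
`χ, χ′` of the centre and a character `η` of `U(J)(F_v)` with open kernel: IF the `(U(1),U(1))` oscillator representation
`ω_{s_L}` of the line block (`s_L = restrictLeft s`) is NON-PERIODIC — no character `η₁ ≠ 1` of `U(J_t)(F_v)` with open
kernel makes `ξ ↦ [Coinv_ξ(ω_{s_L}) ≠ 0]` invariant under `ξ ↦ ξ·η₁` — THEN `Θ_s(χ) ≅ η ⊗ Θ_s(χ′)` forces `η = 1`.

Proof: restrict the isomorphism to the line block `U(J_t)(F_v)` (`BlockSum.inlLoc`): the `ξ`-coinvariants of
`Θ_s(χ)|U(J_t)` and of `(η ⊗ Θ_s(χ′))|U(J_t)` are isomorphic (`TwistedCoinv.mapEquiv`), the latter are the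
`ξ·η_L⁻¹`-coinvariants of `Θ_s(χ′)|U(J_t)` (`η_L = η ∘ inlLoc`, `TwistedCoinv.ker_eq_of_forall_smul`); by
`nontrivial_coinv_line_iff` (both sides, stable range for the isotropic plane) the type set of `ω_{s_L}` is invariant
under `ξ ↦ ξ·η_L⁻¹`, so `η_L = 1` by non-periodicity; finally a character of `U(J)(F_v)` depends only on the determinant
(`UnitaryGroup.LocalRankThree.apply_eq_of_det_eq`, [Dieudonne1971GroupesClassiques, II §5]) and every norm-one
determinant is realised by the line block, so `η = 1`.

HC_CM is NOT proved here; this is the block form of «IV-4c3 ⟸ NonPeriodic₁₁» (the residual rank-1×1 statement is the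
explicit `(U(1),U(1))` ε-dichotomy, [HarrisKudlaSweet1996, Thm. 6.1] + ε-twisting) and is proved only modulo the printed
citations until rung 0 closes.

## References
* [MoeglinVignerasWaldspurger1987] LNM 1291 (1987), Chap. 2 II.1 Rem. (6), Chap. 3 IV.2–IV.4.
* [GelbartRogawski1991] S. Gelbart, J. Rogawski, Invent. Math. 105 (1991), §3 pp. 461–462 (attribution to [GR90] Prop. 5.1.4).
* [Dieudonne1971GroupesClassiques] J. Dieudonné, *La géométrie des groupes classiques* (1971), Chap. II §5.
-/

set_option autoImplicit false

noncomputable section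

open NumberField IsDedekindDomain Matrix
open scoped TensorProduct Matrix MatrixGroups
open Literature.RepresentationTheory.HeisenbergGroup (MpPsi)
open Literature.RepresentationTheory.TwistedCoinv
open Literature.NumberTheory.GelbartRogawski1991.UnitaryDualPair.LocalSplitting
open Literature.NumberTheory.GelbartRogawski1991.UnitaryDualPair.LocalSplitting.BlockSum
open Literature.NumberTheory.Automorphic
open Literature.NumberTheory.Automorphic.Liu2021

namespace Literature.RepresentationTheory.MoeglinVignerasWaldspurger1987

/-! ## §0 Two folklore facts on characters of topological groups -/

/-- A homomorphism into `ℂˣ` with open kernel is continuous. [folklore] -/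
private theorem continuous_of_isOpen_ker_aux {Γ : Type*} [Group Γ] [TopologicalSpace Γ] [IsTopologicalGroup Γ]
    (ψ : Γ →* ℂˣ) (hψ : IsOpen ((ψ.ker : Subgroup Γ) : Set Γ)) : Continuous ψ := by
  refine (IsLocallyConstant.iff_exists_open _).2 (fun γ => ?_) |>.continuous
  refine ⟨(fun κ => γ * κ) '' (ψ.ker : Set Γ), (isOpenMap_mul_left γ) _ hψ, ⟨1, ψ.ker.one_mem, mul_one γ⟩, ?_⟩
  rintro _ ⟨κ, hκ, rfl⟩
  rw [map_mul, (MonoidHom.mem_ker).1 hκ, mul_one]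

/-- A continuous `ℂˣ`-valued character of a compact group is unitary. [folklore] -/
private theorem norm_apply_eq_one_of_compactSpace_aux {Γ : Type*} [Group Γ] [TopologicalSpace Γ] [CompactSpace Γ]
    (ψ : Γ →* ℂˣ) (hψ : Continuous ψ) (γ : Γ) : ‖((ψ γ : ℂˣ) : ℂ)‖ = 1 := by
  have hc : Continuous fun τ : Γ => ‖((ψ τ : ℂˣ) : ℂ)‖ :=
    continuous_norm.comp (Units.continuous_val.comp hψ)
  obtain ⟨M, hM⟩ := (isCompact_range hc).isBounded.bddAbove
  have hle : ∀ τ : Γ, ‖((ψ τ : ℂˣ) : ℂ)‖ ≤ 1 := fun τ => not_lt.mp fun hlt => by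
    obtain ⟨m, hm⟩ := pow_unbounded_of_one_lt M hlt
    have hm' : ‖((ψ τ : ℂˣ) : ℂ)‖ ^ m ≤ M := by
      have h := hM (Set.mem_range_self (τ ^ m))
      simpa only [map_pow, Units.val_pow_eq_pow_val, norm_pow] using h
    exact absurd hm' (not_le.mpr hm)
  refine le_antisymm (hle γ) ?_
  have h1 := hle γ⁻¹
  rw [map_inv, Units.val_inv_eq_inv_val, norm_inv] at h1
  exact (inv_le_one₀ (norm_pos_iff.mpr (Units.ne_zero _))).mp h1

/-! ## §0′ Two generic facts on twisted coinvariants of restrictions -/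

/-- Isomorphic representations have isomorphic `ξ`-coinvariants after restriction along any `i : H →* G`.
[cite: GelbartRogawski1991, §3.1 Remark p. 457] -/
private theorem nontrivial_coinv_comp_iff_of_areIsomorphicRep {G H V₁ V₂ : Type*} [Group G] [Group H]
    [AddCommGroup V₁] [Module ℂ V₁] [AddCommGroup V₂] [Module ℂ V₂]
    {ρ₁ : Representation ℂ G V₁} {ρ₂ : Representation ℂ G V₂} (h : AreIsomorphicRep ρ₁ ρ₂) (i : H →* G)
    (ξ : H →* ℂˣ) : Nontrivial (Coinv (ρ₁.comp i) ξ) ↔ Nontrivial (Coinv (ρ₂.comp i) ξ) := by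
  obtain ⟨A, hA⟩ := h
  exact (mapEquiv (ρ₁.comp i) ξ (ρ₂.comp i) ξ A 1
    (fun u x => by rw [Pi.one_apply, Units.val_one, one_smul]; exact (hA (i u) x).symm)
    (fun u => (one_mul _).symm)).toEquiv.nontrivial_congr

/-- The `ξ`-coinvariants of the twist `η ⊗ ρ` restricted along `i : H →* G` are the `ξ·(η∘i)⁻¹`-coinvariants of `ρ ∘ i`
(same relation submodule, `TwistedCoinv.ker_eq_of_forall_smul`). [cite: GelbartRogawski1991, §3.1 Remark p. 457] -/
private theorem nontrivial_coinv_twist_comp_iff {G H V : Type*} [Group G] [Group H] [AddCommGroup V] [Module ℂ V]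
    (ρ : Representation ℂ G V) (η : G →* ℂˣ) (i : H →* G) (ξ : H →* ℂˣ) :
    Nontrivial (Coinv ((SeesawScalar.twist η ρ).comp i) ξ) ↔ Nontrivial (Coinv (ρ.comp i) (ξ * (η.comp i)⁻¹)) :=
  (Submodule.quotEquivOfEq _ _ (ker_eq_of_forall_smul (ρW := ρ.comp i) (ρW' := (SeesawScalar.twist η ρ).comp i)
    (χ := ξ * (η.comp i)⁻¹) (χ' := ξ) (η.comp i)
    (fun u x => by simp only [MonoidHom.comp_apply, SeesawScalar.twist_apply])
    (fun u => by rw [MonoidHom.mul_apply, MonoidHom.inv_apply, mul_inv_cancel_comm_assoc]))).toEquiv.nontrivial_congr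

/-! ## §1 The block setting -/

variable (F : Type) [Field F] [NumberField F] (E : Type) [Field E] [NumberField E] [Algebra F E]
  [Algebra.IsQuadraticExtension F E] (c : E ≃ₐ[F] E) {δ : E} (hcδ : c δ = -δ) (hδ : δ ≠ 0) {d : F}
  (hd : δ * δ = algebraMap F E d) (v : HeightOneSpectrum (𝓞 F))
  {t : Matrix (Fin 1) (Fin 1) F} {T₂ : Matrix (Fin 2) (Fin 2) F} (ht : t.IsSymm) (hT₂ : T₂.IsSymm)
  (htd : IsUnit t.det) (hT₂d : IsUnit T₂.det)
  {J₁ : Matrix (Fin 1) (Fin 1) E} (hJ₁ : J₁ = t.map (algebraMap F E))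
  {J₂ : Matrix (Fin 2) (Fin 2) E} (hJ₂ : J₂ = T₂.map (algebraMap F E))
  {J : Matrix (Fin (1 + 2)) (Fin (1 + 2)) E} (hJ : J = (UnitaryGroup.finSum 1 2 t T₂).map (algebraMap F E))
  (s : UnitaryGroup.localPi E c (1 + 2) J v →* LocalMp F (1 + 2) (UnitaryGroup.finSum 1 2 t T₂) v)
  (hs : ∀ g, MpPsi.proj _ (s g) =
    iota F E c (1 + 2) hcδ hδ hd (UnitaryGroup.finSum 1 2 t T₂) (UnitaryGroup.isSymm_finSum ht hT₂) hJ v g)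
  {J' : Matrix (Fin 1) (Fin 1) E} (hJ' : J' 0 0 ≠ 0)

/-! ## §2 From the character of `U(J)(F_v)` to the character of the line block -/

omit [NumberField F] [NumberField E] [Algebra.IsQuadraticExtension F E] in
include htd hJ₁ in
/-- `J₁ 0 0 ≠ 0` for the line `J₁ = t ⊗ 1`, `det t` a unit. [cite: Kudla1984, §1] -/
theorem lineEntry_ne_zero : J₁ 0 0 ≠ 0 := by
  rw [hJ₁, Matrix.map_apply]
  have h : t 0 0 ≠ 0 := by
    have := htd.ne_zero
    rwa [Matrix.det_fin_one] at this
  exact (map_ne_zero _).2 h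

/-! ## §3 Every character of `U(J)(F_v)` trivial on the line block is trivial -/

omit [NumberField F] in
include htd hT₂d in
/-- `det (t ⊕ᶠ T_H)` is a unit. [cite: Kudla1984, §1] -/
theorem isUnit_det_finSum₁₂ : IsUnit (UnitaryGroup.finSum 1 2 t T₂).det :=
  HeisenbergGroup.isUnit_det_of_blocks (finSumFinEquiv : Fin 1 ⊕ Fin 2 ≃ Fin (1 + 2)) t T₂ rfl htd hT₂d

include hcδ hδ ht hT₂ htd hT₂d hJ₁ hJ in
/-- **a character of `U(J)(F_v)` that kills the line block `U(J_t)(F_v) ⊕ 1` is trivial**: a homomorphism into a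
commutative group sees only the determinant (`LocalRankThree.apply_eq_of_det_eq`, rank `1 + 2 = 3`, non-split `v`), and
every norm-one determinant is the determinant of an element `z ⊕ 1` of the line block (`z` the unitary scalar
`scalar_mem_unitaryGroupOfForm`). [cite: Dieudonne1971GroupesClassiques, Chap. II §5] -/
theorem eq_one_of_comp_inlLoc_eq_one (hE : IsField (UnitaryGroup.LocalRing E v))
    (η : UnitaryGroup.localPi E c (1 + 2) J v →* ℂˣ) (hη : η.comp (inlLoc F E c v 1 2 hJ₁ hJ) = 1) : η = 1 := by
  letI : Field (UnitaryGroup.LocalRing E v) := hE.toField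
  set σ := UnitaryGroup.conjLocal E c v with hσdef
  set ψ := UnitaryGroup.localPiEquiv E c (1 + 2) J v with hψ
  set ψ₁ := UnitaryGroup.localPiEquiv E c 1 J₁ v with hψ₁
  -- the character on the matrix form
  set θ : ↥(UnitaryGroup.«local» E c (1 + 2) J v) →* ℂˣ := η.comp ψ.symm.toMonoidHom with hθ
  refine MonoidHom.ext fun g => ?_
  rw [MonoidHom.one_apply]
  have hg : η g = θ (ψ g) := (congrArg η (ψ.symm_apply_apply g)).symm
  rw [hg]
  -- the determinant `ζ` of `ψ g` has norm one
  set G := ψ g with hG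
  have hJu : IsUnit ((UnitaryGroup.adelicForm E (1 + 2) J).map (UnitaryGroup.adeleToLocal E v)).det := by
    rw [UnitaryGroup.localForm_eq_map E (1 + 2) v (UnitaryGroup.finSum 1 2 t T₂) hJ, Matrix.map_map, ← RingHom.coe_comp,
      ← RingHom.mapMatrix_apply, ← RingHom.map_det]
    exact (isUnit_det_finSum₁₂ F htd hT₂d).map _
  have hnorm : σ G.1.1.det * G.1.1.det = 1 := by
    have hm : (G.1.1.map σ)ᵀ * (UnitaryGroup.adelicForm E (1 + 2) J).map (UnitaryGroup.adeleToLocal E v) * G.1.1 =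
        (UnitaryGroup.adelicForm E (1 + 2) J).map (UnitaryGroup.adeleToLocal E v) := mem_unitaryGroupOfForm_iff.1 G.2
    have hdm := congrArg Matrix.det hm
    rw [Matrix.det_mul, Matrix.det_mul, Matrix.det_transpose, ← RingHom.mapMatrix_apply, ← RingHom.map_det] at hdm
    refine mul_right_cancel₀ hJu.ne_zero ?_
    rw [one_mul]
    linear_combination hdm
  -- the unitary scalar `ζ` of the line block
  set ζ : UnitaryGroup.LocalRing E v := G.1.1.det with hζ
  have hζσ : ζ * σ ζ = 1 := by rw [mul_comm]; exact hnorm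
  let ζu : (UnitaryGroup.LocalRing E v)ˣ := ⟨ζ, σ ζ, hζσ, hnorm⟩
  let zG : GL (Fin 1) (UnitaryGroup.LocalRing E v) :=
    Units.map (Matrix.scalar (Fin 1) : UnitaryGroup.LocalRing E v →+* Matrix (Fin 1) (Fin 1)
          (UnitaryGroup.LocalRing E v)).toMonoidHom ζu
  have hzG : zG.1 = Matrix.diagonal fun _ => ζ := rfl
  have hzmem : zG ∈ UnitaryGroup.«local» E c 1 J₁ v := scalar_mem_unitaryGroupOfForm σ _ ζu hnorm
  set z : ↥(UnitaryGroup.«local» E c 1 J₁ v) := ⟨zG, hzmem⟩ with hz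
  -- the element `z ⊕ 1` of the matrix form and its determinant
  have hr1 : (inlLocal F E c v 1 2 hJ₁ hJ z).1.1 = Matrix.reindex (finSumFinEquiv : Fin 1 ⊕ Fin 2 ≃ Fin (1 + 2))
        (finSumFinEquiv : Fin 1 ⊕ Fin 2 ≃ Fin (1 + 2)) (Matrix.fromBlocks (Matrix.diagonal fun _ => ζ) 0 0 1) :=
    rfl
  have hrdet : (inlLocal F E c v 1 2 hJ₁ hJ z).1.1.det = ζ := by
    rw [hr1, Matrix.det_reindex_self, Matrix.det_fromBlocks_zero₂₁, Matrix.det_one, mul_one, Matrix.det_diagonal,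
      Fin.prod_univ_one]
  -- `θ G = θ (z ⊕ 1)` (same determinant), and `θ (z ⊕ 1) = η (inlLoc (ψ₁⁻¹ z)) = 1`
  have h1 : θ G = θ (inlLocal F E c v 1 2 hJ₁ hJ z) :=
    UnitaryGroup.LocalRankThree.apply_eq_of_det_eq E c hcδ hδ (UnitaryGroup.finSum 1 2 t T₂)
      (UnitaryGroup.isSymm_finSum ht hT₂) (isUnit_det_finSum₁₂ F htd hT₂d) hJ v hE θ G _ (by rw [hrdet])
  have h2 : θ (inlLocal F E c v 1 2 hJ₁ hJ z) = η (inlLoc F E c v 1 2 hJ₁ hJ (ψ₁.symm z)) := by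
    change η (ψ.symm (inlLocal F E c v 1 2 hJ₁ hJ z)) = η (ψ.symm (inlLocal F E c v 1 2 hJ₁ hJ (ψ₁ (ψ₁.symm z))))
    rw [ψ₁.apply_symm_apply]
  have h3 : η (inlLoc F E c v 1 2 hJ₁ hJ (ψ₁.symm z)) = 1 := by
    have := DFunLike.congr_fun hη (ψ₁.symm z)
    rwa [MonoidHom.comp_apply, MonoidHom.one_apply] at this
  rw [h1, h2, h3]

/-! ## §4 The type set of `ω_{s_L}` is translated by `η ∘ inlLoc` -/

include htd hJ₂ in
/-- **`Θ_s(χ) ≅ η ⊗ Θ_s(χ′)` translates the type set of `ω_{s_L}` by `(η ∘ inlLoc)⁻¹`**: for `(E_v², T_H ⊗ 1)` isotropic at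
the non-split place `v` and `ω_s` smooth, `Coinv_ξ(ω_{s_L}) ≠ 0 ↔ Coinv_{ξ·(η∘inlLoc)⁻¹}(ω_{s_L}) ≠ 0` for every unitary
continuous `ξ` with `ξ·(η∘inlLoc)⁻¹` unitary continuous (the `U(J_t)`-types of `Θ_s(χ)` and of `Θ_s(χ′)` are those of
`ω_{s_L}`, `nontrivial_coinv_line_iff`; restriction of the isomorphism and untwisting, `TwistedCoinv.mapEquiv` /
`ker_eq_of_forall_smul`). [cite: MoeglinVignerasWaldspurger1987, Chap. 3 IV.4 and Chap. 2 II.1 Rem. (6)]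
[cite: GelbartRogawski1991, §3 pp. 461–462] -/
theorem nontrivial_coinv_iff_mul_inv_of_areIsomorphicRep (hE : IsField (UnitaryGroup.LocalRing E v))
    (hsm : Representation.IsSmooth ((MpPsi.toRep (localSchrodinger F (1 + 2) (UnitaryGroup.finSum 1 2 t T₂) v)).comp s))
    (hJ₂h : (J₂.map c)ᵀ = J₂) (hJ₂det : J₂.det ≠ 0)
    (hiso₂ : LemD1.IsIsotropic (LemD1OfPlace.standingData E v c 2 J₂ hcδ hδ (le_refl 2) hJ₂h hJ₂det))
    (η : UnitaryGroup.localPi E c (1 + 2) J v →* ℂˣ)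
    (χ χ' : (UnitaryGroup.localPi E c 1 J' v) →* ℂˣ) (hχu : ∀ z, ‖((χ z : ℂˣ) : ℂ)‖ = 1) (hχc : Continuous fun z =>
          ((χ z : ℂˣ) : ℂ))
    (hχ'u : ∀ z, ‖((χ' z : ℂˣ) : ℂ)‖ = 1) (hχ'c : Continuous fun z => ((χ' z : ℂˣ) : ℂ))
    (hiso : AreIsomorphicRep (TwistedCoinv.rep (ρW := (MonoidHom.comp (MpPsi.toRep (localSchrodinger F (1 + 2)
          (UnitaryGroup.finSum 1 2 t T₂) v)) s).comp (UnitaryGroup.localCenter E c (1 + 2) J J' hJ' v)) χ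
          (MonoidHom.comp (MpPsi.toRep (localSchrodinger F (1 + 2) (UnitaryGroup.finSum 1 2 t T₂) v)) s) (fun g z
          => (show Commute g ((UnitaryGroup.localCenter E c (1 + 2) J J' hJ' v) z) from
          UnitaryGroup.localCenter_comm E c (1 + 2) J J' hJ' v z g).map (MonoidHom.comp (MpPsi.toRep
          (localSchrodinger F (1 + 2) (UnitaryGroup.finSum 1 2 t T₂) v)) s))) (SeesawScalar.twist η
          (TwistedCoinv.rep (ρW := (MonoidHom.comp (MpPsi.toRep (localSchrodinger F (1 + 2) (UnitaryGroup.finSum 1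
          2 t T₂) v)) s).comp (UnitaryGroup.localCenter E c (1 + 2) J J' hJ' v)) χ' (MonoidHom.comp (MpPsi.toRep
          (localSchrodinger F (1 + 2) (UnitaryGroup.finSum 1 2 t T₂) v)) s) (fun g z => (show Commute g
          ((UnitaryGroup.localCenter E c (1 + 2) J J' hJ' v) z) from UnitaryGroup.localCenter_comm E c (1 + 2) J J'
          hJ' v z g).map (MonoidHom.comp (MpPsi.toRep (localSchrodinger F (1 + 2) (UnitaryGroup.finSum 1 2 t T₂)
          v)) s)))))
    (ξ : (UnitaryGroup.localPi E c 1 J₁ v) →* ℂˣ) (hξu : ∀ u, ‖((ξ u : ℂˣ) : ℂ)‖ = 1) (hξc : Continuous fun u =>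
          ((ξ u : ℂˣ) : ℂ))
    (hξ'u : ∀ u, ‖(((ξ * (η.comp (inlLoc F E c v 1 2 hJ₁ hJ))⁻¹) u : ℂˣ) : ℂ)‖ = 1)
    (hξ'c : Continuous fun u => (((ξ * (η.comp (inlLoc F E c v 1 2 hJ₁ hJ))⁻¹) u : ℂˣ) : ℂ)) :
    Nontrivial (Coinv (MonoidHom.comp (MpPsi.toRep (localSchrodinger F 1 t v)) (restrictLeft F E c v 1 2 hJ₁ hJ hcδ
          hδ hd ht hT₂ hT₂d s hs)) ξ) ↔ Nontrivial (Coinv (MonoidHom.comp (MpPsi.toRep (localSchrodinger F 1 t v))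
          (restrictLeft F E c v 1 2 hJ₁ hJ hcδ hδ hd ht hT₂ hT₂d s hs)) (ξ * (η.comp (inlLoc F E c v 1 2 hJ₁
          hJ))⁻¹)) := by
  -- (a) types of `Θχ|U(J_t)` = types of `ω_{s_L}`; (b) likewise for `χ′` at `ξ·η_L⁻¹`
  have h1 := nontrivial_coinv_line_iff F E c hcδ hδ hd v 1 2 ht hT₂ htd hT₂d hJ₁ hJ₂ hJ s hs hJ' hE hsm (le_refl 2) hJ₂h
    hJ₂det hiso₂ χ hχu hχc ξ hξu hξc
  have h2 := nontrivial_coinv_line_iff F E c hcδ hδ hd v 1 2 ht hT₂ htd hT₂d hJ₁ hJ₂ hJ s hs hJ' hE hsm (le_refl 2) hJ₂h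
    hJ₂det hiso₂ χ' hχ'u hχ'c _ hξ'u hξ'c
  -- (c) `Coinv_ξ(Θχ|U(J_t)) ≃ Coinv_ξ((η ⊗ Θχ′)|U(J_t)) = Coinv_{ξ·η_L⁻¹}(Θχ′|U(J_t))`
  have h3 := nontrivial_coinv_comp_iff_of_areIsomorphicRep hiso (inlLoc F E c v 1 2 hJ₁ hJ) ξ
  have h4 := nontrivial_coinv_twist_comp_iff (TwistedCoinv.rep (ρW := (MonoidHom.comp (MpPsi.toRep
        (localSchrodinger F (1 + 2) (UnitaryGroup.finSum 1 2 t T₂) v)) s).comp (UnitaryGroup.localCenter E c (1 +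
        2) J J' hJ' v)) χ' (MonoidHom.comp (MpPsi.toRep (localSchrodinger F (1 + 2) (UnitaryGroup.finSum 1 2 t T₂)
        v)) s) (fun g z => (show Commute g ((UnitaryGroup.localCenter E c (1 + 2) J J' hJ' v) z) from
        UnitaryGroup.localCenter_comm E c (1 + 2) J J' hJ' v z g).map (MonoidHom.comp (MpPsi.toRep
        (localSchrodinger F (1 + 2) (UnitaryGroup.finSum 1 2 t T₂) v)) s))) η (inlLoc F E c v 1 2 hJ₁ hJ) ξ
  exact h1.symm.trans (h3.trans (h4.trans h2))

/-! ## §5 Twist rigidity in block form modulo non-periodicity of the line block -/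

include htd hJ₂ in
-- thirty-odd binders in block currency, the compact-torus bookkeeping and the translation lemma; about 2× the default budget
set_option maxHeartbeats 400000 in
/-- **TWIST RIGIDITY OF THE RANK-ONE THETA LIFT TO `U(3)`, BLOCK FORM, MODULO NON-PERIODICITY OF THE LINE BLOCK.**
For `T = t ⊕ᶠ T_H` with `(E_v², T_H ⊗ 1)` isotropic at the non-split place `v`, a section `s` over `ι_v` with `ω_s`
      smooth,
unitary continuous `χ, χ′` and a character `η` of `U(J)(F_v)` with open kernel: if the `(U(1),U(1))` oscillator
representation `ω_{s_L}` (`s_L = restrictLeft s`) admits no non-trivial period (hypothesis `hNP`), then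
`Θ_s(χ) ≅ η ⊗ Θ_s(χ′)` implies `η = 1`.  (The type set of `Θ_s(χ)|U(J_t)` is that of `ω_{s_L}` for every `χ` —
`nontrivial_coinv_line_iff` — and twisting by `η` translates it by `η ∘ inlLoc`.)
[cite: MoeglinVignerasWaldspurger1987, Chap. 3 IV.4 and Chap. 2 II.1 Rem. (6)]
[cite: GelbartRogawski1991, §3 pp. 461–462] -/
theorem twistRigid_block_of_nonPeriodic (hE : IsField (UnitaryGroup.LocalRing E v))
    (hsm : Representation.IsSmooth ((MpPsi.toRep (localSchrodinger F (1 + 2) (UnitaryGroup.finSum 1 2 t T₂) v)).comp s))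
    (hJ₂h : (J₂.map c)ᵀ = J₂) (hJ₂det : J₂.det ≠ 0)
    (hiso₂ : LemD1.IsIsotropic (LemD1OfPlace.standingData E v c 2 J₂ hcδ hδ (le_refl 2) hJ₂h hJ₂det))
    (hNP : ∀ (η₁ : (UnitaryGroup.localPi E c 1 J₁ v) →* ℂˣ), IsOpen ((η₁.ker : Subgroup (UnitaryGroup.localPi E c 1
          J₁ v)) : Set (UnitaryGroup.localPi E c 1 J₁ v)) →
      (∀ (ξ : (UnitaryGroup.localPi E c 1 J₁ v) →* ℂˣ), (∀ u, ‖((ξ u : ℂˣ) : ℂ)‖ = 1) → (Continuous fun u => ((ξ u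
            : ℂˣ) : ℂ)) →
        (Nontrivial (Coinv (MonoidHom.comp (MpPsi.toRep (localSchrodinger F 1 t v)) (restrictLeft F E c v 1 2 hJ₁
              hJ hcδ hδ hd ht hT₂ hT₂d s hs)) ξ) ↔ Nontrivial (Coinv (MonoidHom.comp (MpPsi.toRep (localSchrodinger
              F 1 t v)) (restrictLeft F E c v 1 2 hJ₁ hJ hcδ hδ hd ht hT₂ hT₂d s hs)) (ξ * η₁)))) → η₁ = 1)
    (η : UnitaryGroup.localPi E c (1 + 2) J v →* ℂˣ)
    (hη : IsOpen ((η.ker : Subgroup (UnitaryGroup.localPi E c (1 + 2) J v)) : Set (UnitaryGroup.localPi E c (1 + 2)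
          J v)))
    (χ χ' : (UnitaryGroup.localPi E c 1 J' v) →* ℂˣ) (hχu : ∀ z, ‖((χ z : ℂˣ) : ℂ)‖ = 1) (hχc : Continuous fun z =>
          ((χ z : ℂˣ) : ℂ))
    (hχ'u : ∀ z, ‖((χ' z : ℂˣ) : ℂ)‖ = 1) (hχ'c : Continuous fun z => ((χ' z : ℂˣ) : ℂ))
    (hiso : AreIsomorphicRep (TwistedCoinv.rep (ρW := (MonoidHom.comp (MpPsi.toRep (localSchrodinger F (1 + 2)
          (UnitaryGroup.finSum 1 2 t T₂) v)) s).comp (UnitaryGroup.localCenter E c (1 + 2) J J' hJ' v)) χ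
          (MonoidHom.comp (MpPsi.toRep (localSchrodinger F (1 + 2) (UnitaryGroup.finSum 1 2 t T₂) v)) s) (fun g z
          => (show Commute g ((UnitaryGroup.localCenter E c (1 + 2) J J' hJ' v) z) from
          UnitaryGroup.localCenter_comm E c (1 + 2) J J' hJ' v z g).map (MonoidHom.comp (MpPsi.toRep
          (localSchrodinger F (1 + 2) (UnitaryGroup.finSum 1 2 t T₂) v)) s))) (SeesawScalar.twist η
          (TwistedCoinv.rep (ρW := (MonoidHom.comp (MpPsi.toRep (localSchrodinger F (1 + 2) (UnitaryGroup.finSum 1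
          2 t T₂) v)) s).comp (UnitaryGroup.localCenter E c (1 + 2) J J' hJ' v)) χ' (MonoidHom.comp (MpPsi.toRep
          (localSchrodinger F (1 + 2) (UnitaryGroup.finSum 1 2 t T₂) v)) s) (fun g z => (show Commute g
          ((UnitaryGroup.localCenter E c (1 + 2) J J' hJ' v) z) from UnitaryGroup.localCenter_comm E c (1 + 2) J J'
          hJ' v z g).map (MonoidHom.comp (MpPsi.toRep (localSchrodinger F (1 + 2) (UnitaryGroup.finSum 1 2 t T₂)
          v)) s))))) : η = 1 := by
  /- §0 the non-split place: `c ≠ 1`, the fixed place `w`, compact line block -/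
  have hc1 : c ≠ 1 := by
    rintro rfl
    exact hδ (self_eq_neg.1 (by simpa only [AlgEquiv.one_apply] using hcδ))
  obtain ⟨w⟩ := (inferInstance : Nonempty (UnitaryGroup.PlacesOver E v))
  have hw : c • w.1 = w.1 := by
    by_contra hw
    exact LemD1IndexedNonVacuityAtPlace.not_isField_localRing_of_split E v c w hw hE
  haveI : CompactSpace (UnitaryGroup.localPi E c 1 J₁ v) :=
    UnitaryGroup.compactSpace_localPi_one_of_smul_eq c J₁ hc1 (lineEntry_ne_zero F E htd hJ₁) w hw
  /- §1 the character of the line block: open kernel, continuous, unitary -/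
  set ηL : (UnitaryGroup.localPi E c 1 J₁ v) →* ℂˣ := η.comp (inlLoc F E c v 1 2 hJ₁ hJ) with hηL
  have hηLo : IsOpen ((ηL.ker : Subgroup (UnitaryGroup.localPi E c 1 J₁ v)) : Set (UnitaryGroup.localPi E c 1 J₁
        v)) := by
    rw [hηL, ← MonoidHom.comap_ker]
    exact hη.preimage (continuous_inlLoc F E c v 1 2 hJ₁ hJ)
  have hηLc : Continuous ηL := continuous_of_isOpen_ker_aux ηL hηLo
  have hηLu : ∀ u, ‖((ηL u : ℂˣ) : ℂ)‖ = 1 := norm_apply_eq_one_of_compactSpace_aux ηL hηLc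
  have hηLc' : Continuous fun u => ((ηL u : ℂˣ) : ℂ) := Units.continuous_val.comp hηLc
  /- §2 the type sets of `Θ_s(χ)|U(J_t)` and `Θ_s(χ′)|U(J_t)` differ by the translation `η_L⁻¹` -/
  have key : ∀ (ξ : (UnitaryGroup.localPi E c 1 J₁ v) →* ℂˣ), (∀ u, ‖((ξ u : ℂˣ) : ℂ)‖ = 1) → (Continuous fun u =>
        ((ξ u : ℂˣ) : ℂ)) →
      (Nontrivial (Coinv (MonoidHom.comp (MpPsi.toRep (localSchrodinger F 1 t v)) (restrictLeft F E c v 1 2 hJ₁ hJ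
            hcδ hδ hd ht hT₂ hT₂d s hs)) ξ) ↔ Nontrivial (Coinv (MonoidHom.comp (MpPsi.toRep (localSchrodinger F 1
            t v)) (restrictLeft F E c v 1 2 hJ₁ hJ hcδ hδ hd ht hT₂ hT₂d s hs)) (ξ * ηL⁻¹))) := by
    intro ξ hξu hξc
    have hξ'u : ∀ u, ‖(((ξ * ηL⁻¹) u : ℂˣ) : ℂ)‖ = 1 := fun u => by
      rw [MonoidHom.mul_apply, MonoidHom.inv_apply, Units.val_mul, norm_mul, hξu, Units.val_inv_eq_inv_val, norm_inv,
        hηLu, inv_one, mul_one]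
    have hξ'c : Continuous fun u => (((ξ * ηL⁻¹) u : ℂˣ) : ℂ) := by
      have h3 : (fun u => (((ξ * ηL⁻¹) u : ℂˣ) : ℂ)) = fun u => ((ξ u : ℂˣ) : ℂ) * (((ηL u : ℂˣ) : ℂ))⁻¹ := by
        funext u
        rw [MonoidHom.mul_apply, MonoidHom.inv_apply, Units.val_mul, Units.val_inv_eq_inv_val]
      rw [h3]
      exact hξc.mul (hηLc'.inv₀ fun u => Units.ne_zero _)
    exact nontrivial_coinv_iff_mul_inv_of_areIsomorphicRep F E c hcδ hδ hd v ht hT₂ htd hT₂d hJ₁ hJ₂ hJ s hs hJ' hE hsm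
      hJ₂h hJ₂det hiso₂ η χ χ' hχu hχc hχ'u hχ'c hiso ξ hξu hξc hξ'u hξ'c
  /- §3 non-periodicity: `η_L⁻¹ = 1` -/
  have hL : ηL⁻¹ = 1 := by
    refine hNP ηL⁻¹ ?_ key
    have hker : ((ηL⁻¹).ker : Subgroup (UnitaryGroup.localPi E c 1 J₁ v)) = ηL.ker := by
      ext u
      rw [MonoidHom.mem_ker, MonoidHom.mem_ker, MonoidHom.inv_apply, inv_eq_one]
    rw [hker]
    exact hηLo
  have hL1 : ηL = 1 := by
    refine MonoidHom.ext fun u => ?_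
    have hu := DFunLike.congr_fun hL u
    rw [MonoidHom.inv_apply, MonoidHom.one_apply, inv_eq_one] at hu
    rw [hu, MonoidHom.one_apply]
  /- §4 from the line block to the whole group -/
  exact eq_one_of_comp_inlLoc_eq_one F E c hcδ hδ v ht hT₂ htd hT₂d hJ₁ hJ hE η (by rw [← hηL]; exact hL1)

end Literature.RepresentationTheory.MoeglinVignerasWaldspurger1987

end
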